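import Summits.QuantumFields.BalabanUV.T4Continuum.Support.NE7DatumCoordinateStabiliser
import Summits.QuantumFields.BalabanUV.T4Continuum.Support.NE3EnergyShapes
import Literature.MathematicalPhysics.QuantumFieldTheory.Balaban1983to89.MatrixLogLipschitz
import Literature.Analysis.Complex.RungeUnits
import Mathlib.Topology.Algebra.Star.Unitary
import Mathlib.LinearAlgebra.Projection
import Mathlib.Topology.Algebra.Module.FiniteDimension
import HarnessLib

/-!
# NE7NearStabiliser — NEAR-STABILISERS OF A LATTICE GAUGE DATUM ARE NEAR ITS STABILISER, AT A LINEAR RATE: for a unitary `N`-periodic datum `V₀` on `ℤ^d` there is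
# `C = C(V₀, N)` such that every unitary `N`-periodic site field `g` admits a unitary `N`-periodic `s` FIXING `V₀` (`s·V₀ = V₀`) with `‖g(z) − s(z)‖ ≤ C·η` as soon as
# `g` moves `V₀` by at most `η` bondwise (`‖V₀(b)⁻¹(g·V₀)(b) − 1‖ ≤ η` on the period box) — the orbit-geometry letter that closes the «optimal gauge» loop of gen 114's
# LIPSCHITZ dependence of the constrained minimiser `U_k(V)` on `V` (the gauge produced by the coercivity decomposition moves the base datum by `O(‖X′‖)`; this file turns
# it into an honest stabiliser element at the same cost)

Cell `pub-balaban`, rung (B)+1 sub-cell t4, lineage `b2b-balaban-t4-ne7-p1` (CRUX PROVER NE7 #1 = OWNER of BINDER row NE7), generation 114.  Memo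
`t4/b2b-balaban-t4-ne7-p1-g114/ROAD-G114.md` §3.
THE ARGUMENT (the stabiliser condition `s(z)V₀(z,κ) = V₀(z,κ)s(z+e_κ)` is LINEAR in `s`).  (A) finite-dimensional linear algebra: for a linear `Λ` between finite-dimensional
normed spaces, `dist(x, ker Λ) ≤ C_Λ‖Λx‖` (a complement of the kernel, `LinearEquiv.ofInjective`, continuity of the inverse).  (B) near the identity: `B = log g` (skew) has
defect `‖ΛB‖ ≤ (4∕3)‖Λg‖` (the logarithm is Lipschitz near `1` and commutes with unitary conjugation); project `B` to `a ∈ ker Λ`, take the skew part (the kernel is closed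
under `x ↦ x†` because `V₀` is unitary), exponentiate: `s = e^{a′}` is unitary, in the kernel (closed under `exp`, conjugation again: Mathlib `exp_units_conj`), and `‖g − s‖ = ‖e^{B} −
e^{a′}‖ ≤ e^{1∕2+3C_Λ}‖B − a′‖`.  (C) globalisation by compactness of the unitary fields: near a stabiliser element `s₀` apply (B) to `s₀†g` (same defect); away from
every stabiliser element the defect is bounded below, so `s = 1` will do.  (D) the torus: sites `[0,N)^d`, bond labels `κ`, neighbour `z + e_κ mod N`; periodic extension.
WHAT ([folklore]; 0 def, 0 sorry; any `U(n)`).  `exists_ker_approx` (A); **`near_stabiliser_core`** (B)+(C) for an arbitrary finite bond structure (sites `ι`, bond labels `β`,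
neighbour map `nb`, unitary bond values `Vb`); the torus form (D) is the companion file `NE7NearStabiliserTorus`.
HONEST FRAMING (page 1): elementary matrix analysis and compactness; `C` is EXISTENTIAL (depends on `V₀`, `N`, `n`), no rate in `N`; nothing of Bałaban's asserted; NOT NE7,
NOT NE3; spine 0∕9; finite T⁴ rung (B)+1 — NOT infinite volume, NOT mass gap, NOT BetaPertH, NOT Clay (continuum YM on T⁴ ⇐ BetaPertH ∧ nine spine estimates).
-/

set_option autoImplicit false

open scoped BigOperators Matrix Matrix.Norms.L2Operator Topology NNReal
open NormedSpace Set Filter Metric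

namespace Summit.QuantumFields.BalabanUV.T4Continuum.NE7NearStabiliser

open Literature.MathematicalPhysics.QuantumFieldTheory.Balaban1983to89
open B7Prop1Explicit B7Prop2Explicit MatrixLog UnitaryModel
open MatrixLogLipschitz (norm_mlog_sub_mlog_le)
open T4AveragingDeficitWall (IsUnitaryCfg)
open T4AveragingDeficitWallBoundary (IsPeriodicCfg)
open AveragingDeficitTorusChart (skewP skewP_apply skewP_mem skewP_of_mem)
open NE3EnergyShapes (IsUnitarySite IsPeriodicSite)
open NE7TorusChartDecoding (norm_skewP_le)
open NE7DatumCoordinateStabiliser (norm_conj_unitary mlog_conj_unitary inv_mem_unitary)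

noncomputable section

/-! ## §1 (A) Distance to the kernel of a linear map between finite-dimensional spaces -/

/-- **`dist(x, ker Λ) ≤ C‖Λ x‖`** for a linear map between finite-dimensional real normed spaces. [folklore] -/
theorem exists_ker_approx {E F : Type*} [NormedAddCommGroup E] [NormedSpace ℝ E] [FiniteDimensional ℝ E]
    [NormedAddCommGroup F] [NormedSpace ℝ F] [FiniteDimensional ℝ F] (Λ : E →ₗ[ℝ] F) :
    ∃ C : ℝ, 0 ≤ C ∧ ∀ x : E, ∃ a : E, Λ a = 0 ∧ ‖x - a‖ ≤ C * ‖Λ x‖ := by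
  obtain ⟨W, hW⟩ := (LinearMap.ker Λ).exists_isCompl
  set ΛW : ↥W →ₗ[ℝ] F := Λ.domRestrict W with hΛW
  have hinj : Function.Injective ΛW := by
    refine (injective_iff_map_eq_zero ΛW).mpr fun w hw => ?_
    have h1 : (w : E) ∈ LinearMap.ker Λ := by
      rw [LinearMap.mem_ker]; simpa [hΛW] using hw
    have h2 : (w : E) ∈ LinearMap.ker Λ ⊓ W := ⟨h1, w.2⟩
    rw [hW.inf_eq_bot, Submodule.mem_bot] at h2
    exact_mod_cast h2
  set e := LinearEquiv.ofInjective ΛW hinj with he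
  set T : ↥(LinearMap.range ΛW) →L[ℝ] ↥W := (e.symm.toContinuousLinearEquiv : ↥(LinearMap.range ΛW) →L[ℝ] ↥W) with hT
  refine ⟨‖T‖, ContinuousLinearMap.opNorm_nonneg T, fun x => ?_⟩
  set a : E := (LinearMap.ker Λ).projection W hW x with ha
  have haK : a ∈ LinearMap.ker Λ := Submodule.projection_apply_mem hW x
  have hwW : x - a ∈ W := Submodule.sub_projection_mem hW x
  refine ⟨a, LinearMap.mem_ker.mp haK, ?_⟩
  set w : ↥W := ⟨x - a, hwW⟩ with hw
  have hΛx : Λ x = ΛW w := by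
    have h0 : Λ a = 0 := LinearMap.mem_ker.mp haK
    have h1 : ΛW w = Λ (x - a) := rfl
    rw [h1, map_sub, h0, sub_zero]
  have h2 : T (e w) = w := by
    rw [hT]
    exact e.symm_apply_apply w
  have h3 : ‖(e w : F)‖ = ‖ΛW w‖ := by rw [he, LinearEquiv.ofInjective_apply]
  calc ‖x - a‖ = ‖w‖ := rfl
    _ = ‖T (e w)‖ := by rw [h2]
    _ ≤ ‖T‖ * ‖e w‖ := T.le_opNorm _
    _ = ‖T‖ * ‖Λ x‖ := by rw [hΛx, ← h3]; rfl


/-! ## §2 Letters: conjugation by a unitary matrix -/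

variable {n : Type*} [Fintype n] [DecidableEq n]

/-- The unit attached to a unitary matrix `V`, with inverse `V†`. [folklore] -/
theorem exists_unit_of_unitary {V : Matrix n n ℂ} (hV : V ∈ unitary (Matrix n n ℂ)) :
    ∃ c : (Matrix n n ℂ)ˣ, c ∈ unitaryUnits (Matrix n n ℂ) ∧ (c : Matrix n n ℂ) = V ∧ ((c⁻¹ : (Matrix n n ℂ)ˣ) : Matrix n n ℂ) = star V := by
  refine ⟨Unitary.toUnits ⟨V, hV⟩, ?_, rfl, ?_⟩
  · exact mem_unitaryUnits.mpr (by simpa using hV)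
  · exact Units.inv_eq_of_mul_eq_one_left (by simpa using Unitary.star_mul_self_of_mem hV)

/-- `log(V Z V†) = V (log Z) V†` for unitary `V` and `‖Z − 1‖ < 1`. [folklore] -/
theorem mlog_conj_unitary' [Nonempty n] {V : Matrix n n ℂ} (hV : V ∈ unitary (Matrix n n ℂ)) {Z : Matrix n n ℂ} (hZ : ‖Z - 1‖ < 1) :
    mlog (V * Z * star V) = V * mlog Z * star V := by
  obtain ⟨c, hc, hcV, hcinv⟩ := exists_unit_of_unitary hV
  rw [← hcinv, ← hcV]
  exact mlog_conj_unitary hc hZ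

/-- `‖V X V†‖ = ‖X‖` for unitary `V`. [folklore] -/
theorem norm_conj_unitary' [Nonempty n] {V : Matrix n n ℂ} (hV : V ∈ unitary (Matrix n n ℂ)) (X : Matrix n n ℂ) :
    ‖V * X * star V‖ = ‖X‖ := by
  letI : CStarAlgebra (Matrix n n ℂ) := {}
  rw [CStarRing.norm_mul_mem_unitary _ (Unitary.star_mem hV), CStarRing.norm_mem_unitary_mul _ hV]

/-! ## §3 (B)+(C) The core: an arbitrary finite bond structure -/

set_option maxHeartbeats 1600000 in
/-- **NEAR-STABILISERS ARE NEAR THE STABILISER — CORE FORM.**  Finite index types `ι` (sites) and `β` (bond labels), a neighbour map `nb : ι → β → ι` and unitary bond values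
`Vb : ι → β → U(n)`.  THEN `∃ C ≥ 0` such that for every unitary site field `g : ι → U(n)` and every `η ≥ 0` with `‖g(i)·Vb(i,b) − Vb(i,b)·g(nb i b)‖ ≤ η` for all `i, b`,
there is a unitary `s : ι → U(n)` with `s(i)·Vb(i,b) = Vb(i,b)·s(nb i b)` for all `i, b` (a stabiliser element) and `‖g(i) − s(i)‖ ≤ C·η` for all `i`. [folklore] -/
theorem near_stabiliser_core [Nonempty n] {ι β : Type*} [Fintype ι] [Fintype β] (nb : ι → β → ι) (Vb : ι → β → Matrix n n ℂ)
    (hVb : ∀ i b, Vb i b ∈ unitary (Matrix n n ℂ)) :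
    ∃ C : ℝ, 0 ≤ C ∧ ∀ g : ι → Matrix n n ℂ, (∀ i, g i ∈ unitary (Matrix n n ℂ)) → ∀ η : ℝ, 0 ≤ η →
      (∀ i b, ‖g i * Vb i b - Vb i b * g (nb i b)‖ ≤ η) →
      ∃ s : ι → Matrix n n ℂ, (∀ i, s i ∈ unitary (Matrix n n ℂ)) ∧ (∀ i b, s i * Vb i b = Vb i b * s (nb i b)) ∧ ∀ i, ‖g i - s i‖ ≤ C * η := by
  letI : CStarAlgebra (Matrix n n ℂ) := {}
  letI : NormedAlgebra ℚ (Matrix n n ℂ) := NormedAlgebra.restrictScalars ℚ ℂ (Matrix n n ℂ)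
  -- the defect map
  set Λ : (ι → Matrix n n ℂ) →ₗ[ℝ] (ι → β → Matrix n n ℂ) :=
    { toFun := fun x i b => x i * Vb i b - Vb i b * x (nb i b)
      map_add' := fun x y => by funext i b; simp only [Pi.add_apply]; noncomm_ring
      map_smul' := fun c x => by funext i b; simp only [Pi.smul_apply, RingHom.id_apply, smul_sub, smul_mul_assoc, mul_smul_comm] } with hΛdef
  have hΛ : ∀ (x : ι → Matrix n n ℂ) i b, Λ x i b = x i * Vb i b - Vb i b * x (nb i b) := fun _ _ _ => rfl
  have hΛnorm : ∀ (x : ι → Matrix n n ℂ) (η : ℝ), 0 ≤ η → (∀ i b, ‖x i * Vb i b - Vb i b * x (nb i b)‖ ≤ η) → ‖Λ x‖ ≤ η := by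
    intro x η hη h
    refine (pi_norm_le_iff_of_nonneg hη).mpr fun i => (pi_norm_le_iff_of_nonneg hη).mpr fun b => ?_
    rw [hΛ]; exact h i b
  have hΛcomp : ∀ (x : ι → Matrix n n ℂ) i b, ‖Λ x i b‖ ≤ ‖Λ x‖ := fun x i b => (norm_le_pi_norm (Λ x i) b).trans (norm_le_pi_norm (Λ x) i)
  have hker : ∀ x : ι → Matrix n n ℂ, Λ x = 0 ↔ ∀ i b, x i * Vb i b = Vb i b * x (nb i b) := by
    intro x
    constructor
    · intro h i b
      have h1 : Λ x i b = 0 := by rw [h]; rfl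
      rw [hΛ] at h1
      exact sub_eq_zero.mp h1
    · intro h
      funext i b
      rw [hΛ]
      exact sub_eq_zero.mpr (h i b)
  -- closure of the kernel under star, products, `1`, `exp`
  have hV1 : ∀ i b, star (Vb i b) * Vb i b = 1 := fun i b => Unitary.star_mul_self_of_mem (hVb i b)
  have hV2 : ∀ i b, Vb i b * star (Vb i b) = 1 := fun i b => Unitary.mul_star_self_of_mem (hVb i b)
  have hconj : ∀ (x : ι → Matrix n n ℂ), Λ x = 0 → ∀ i b, Vb i b * x (nb i b) * star (Vb i b) = x i := by
    intro x hx i b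
    rw [← (hker x).mp hx i b, mul_assoc, hV2, mul_one]
  have hkstar : ∀ x : ι → Matrix n n ℂ, Λ x = 0 → Λ (fun i => star (x i)) = 0 := by
    intro x hx
    refine (hker _).mpr fun i b => ?_
    have h := congrArg star (hconj x hx i b)
    rw [star_mul, star_mul, star_star, ← mul_assoc] at h
    -- `h : Vb · star (x (nb i b)) · star Vb = star (x i)`
    calc star (x i) * Vb i b = Vb i b * star (x (nb i b)) * star (Vb i b) * Vb i b := by rw [h]
      _ = Vb i b * star (x (nb i b)) := by rw [mul_assoc, hV1, mul_one]
  have hkmul : ∀ x y : ι → Matrix n n ℂ, Λ x = 0 → Λ y = 0 → Λ (fun i => x i * y i) = 0 := by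
    intro x y hx hy
    refine (hker _).mpr fun i b => ?_
    have h1 := (hker x).mp hx i b
    have h2 := (hker y).mp hy i b
    calc x i * y i * Vb i b = x i * (y i * Vb i b) := by rw [mul_assoc]
      _ = x i * (Vb i b * y (nb i b)) := by rw [h2]
      _ = (x i * Vb i b) * y (nb i b) := by rw [mul_assoc]
      _ = Vb i b * (x (nb i b) * y (nb i b)) := by rw [h1, mul_assoc]
  have hkone : Λ (fun _ => 1) = 0 := (hker _).mpr fun i b => by rw [one_mul, mul_one]
  have hexpconj : ∀ (i : ι) (b : β) (X : Matrix n n ℂ), exp (Vb i b * X * star (Vb i b)) = Vb i b * exp X * star (Vb i b) := fun i b X =>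
    exp_units_conj ⟨Vb i b, star (Vb i b), hV2 i b, hV1 i b⟩ X
  have hkexp : ∀ x : ι → Matrix n n ℂ, Λ x = 0 → Λ (fun i => exp (x i)) = 0 := by
    intro x hx
    refine (hker _).mpr fun i b => ?_
    have h := hconj x hx i b
    calc exp (x i) * Vb i b = exp (Vb i b * x (nb i b) * star (Vb i b)) * Vb i b := by rw [h]
      _ = Vb i b * exp (x (nb i b)) * star (Vb i b) * Vb i b := by rw [hexpconj]
      _ = Vb i b * exp (x (nb i b)) := by rw [mul_assoc, hV1, mul_one]
  -- (A) the kernel estimate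
  obtain ⟨CA, hCA, hA⟩ := exists_ker_approx Λ
  -- (B) THE LOCAL LEMMA near the identity
  set Cloc : ℝ := CA * (4 / 3) * Real.exp (1 / 2 + 3 * CA) with hCloc
  have hCloc0 : 0 ≤ Cloc := by rw [hCloc]; positivity
  have hdef2 : ∀ g : ι → Matrix n n ℂ, (∀ i, g i ∈ unitary (Matrix n n ℂ)) → ‖Λ g‖ ≤ 2 := by
    intro g hg
    refine hΛnorm g 2 (by norm_num) fun i b => ?_
    calc ‖g i * Vb i b - Vb i b * g (nb i b)‖ ≤ ‖g i * Vb i b‖ + ‖Vb i b * g (nb i b)‖ := norm_sub_le _ _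
      _ = 1 + 1 := by
        rw [CStarRing.norm_mul_mem_unitary _ (hVb i b), CStarRing.norm_mem_unitary_mul _ (hVb i b),
          CStarRing.norm_of_mem_unitary (hg i), CStarRing.norm_of_mem_unitary (hg (nb i b))]
      _ = 2 := by norm_num
  have hlocal : ∀ g : ι → Matrix n n ℂ, (∀ i, g i ∈ unitary (Matrix n n ℂ)) → (∀ i, ‖g i - 1‖ ≤ 1 / 4) →
      ∃ s : ι → Matrix n n ℂ, (∀ i, s i ∈ unitary (Matrix n n ℂ)) ∧ Λ s = 0 ∧ ∀ i, ‖g i - s i‖ ≤ Cloc * ‖Λ g‖ := by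
    intro g hg hg1
    set B : ι → Matrix n n ℂ := fun i => mlog (g i) with hBdef
    have hBskew : ∀ i, star (B i) = -B i := fun i => star_mlog_eq_neg (hg i) (hg1 i)
    have hBn : ∀ i, ‖B i‖ ≤ 1 / 2 := fun i => (norm_mlog_le_two_mul ((hg1 i).trans (by norm_num))).trans (by linarith [hg1 i])
    have hexpB : ∀ i, exp (B i) = g i := fun i => exp_mlog ((hg1 i).trans_lt (by norm_num))
    -- the defect of `B`
    have hΛB : ‖Λ B‖ ≤ (4 / 3) * ‖Λ g‖ := by
      refine hΛnorm B _ (by positivity) fun i b => ?_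
      have hconjn : ‖Vb i b * g (nb i b) * star (Vb i b) - 1‖ ≤ 1 / 4 := by
        have e1 : Vb i b * g (nb i b) * star (Vb i b) - 1 = Vb i b * (g (nb i b) - 1) * star (Vb i b) := by
          rw [mul_sub, sub_mul, mul_one, hV2]
        rw [e1, norm_conj_unitary' (hVb i b)]; exact hg1 (nb i b)
      have h1 : B i * Vb i b - Vb i b * B (nb i b) = (B i - Vb i b * B (nb i b) * star (Vb i b)) * Vb i b := by
        rw [sub_mul, mul_assoc (Vb i b * B (nb i b)), hV1, mul_one]
      have h2 : Vb i b * B (nb i b) * star (Vb i b) = mlog (Vb i b * g (nb i b) * star (Vb i b)) := by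
        rw [hBdef]; exact (mlog_conj_unitary' (hVb i b) ((hg1 (nb i b)).trans_lt (by norm_num))).symm
      have h3 := norm_mlog_sub_mlog_le (r := 1 / 4) (by norm_num) (hg1 i) hconjn
      have h4 : g i - Vb i b * g (nb i b) * star (Vb i b) = (g i * Vb i b - Vb i b * g (nb i b)) * star (Vb i b) := by
        rw [sub_mul, mul_assoc (g i), hV2, mul_one]
      rw [h1, CStarRing.norm_mul_mem_unitary _ (hVb i b), h2]
      calc ‖mlog (g i) - mlog (Vb i b * g (nb i b) * star (Vb i b))‖ ≤ ‖g i - Vb i b * g (nb i b) * star (Vb i b)‖ / (1 - 1 / 4) := h3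
        _ = (4 / 3) * ‖g i * Vb i b - Vb i b * g (nb i b)‖ := by rw [h4, CStarRing.norm_mul_mem_unitary _ (Unitary.star_mem (hVb i b))]; ring
        _ ≤ (4 / 3) * ‖Λ g‖ := by rw [← hΛ]; exact mul_le_mul_of_nonneg_left (hΛcomp g i b) (by norm_num)
    -- project onto the kernel and take the skew part
    obtain ⟨a, haK, haB⟩ := hA B
    set a' : ι → Matrix n n ℂ := fun i => skewP (a i) with ha'
    have ha'K : Λ a' = 0 := by
      have hs := hkstar a haK
      refine (hker _).mpr fun i b => ?_
      have h1 := (hker a).mp haK i b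
      have h2 := (hker _).mp hs i b
      simp only [ha', skewP_apply, smul_mul_assoc, mul_smul_comm, sub_mul, mul_sub]
      rw [h1, h2]
    have ha'skew : ∀ i, a' i ∈ skewAdjoint (Matrix n n ℂ) := fun i => skewP_mem (a i)
    have hBa' : ∀ i, ‖B i - a' i‖ ≤ CA * (4 / 3) * ‖Λ g‖ := by
      intro i
      have hBi : skewP (B i) = B i := skewP_of_mem (skewAdjoint.mem_iff.mpr (hBskew i))
      calc ‖B i - a' i‖ = ‖skewP (B i - a i)‖ := by rw [map_sub, hBi]
        _ ≤ ‖B i - a i‖ := norm_skewP_le _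
        _ ≤ ‖B - a‖ := norm_le_pi_norm (B - a) i
        _ ≤ CA * ‖Λ B‖ := haB
        _ ≤ CA * ((4 / 3) * ‖Λ g‖) := mul_le_mul_of_nonneg_left hΛB hCA
        _ = CA * (4 / 3) * ‖Λ g‖ := by ring
    -- exponentiate
    refine ⟨fun i => exp (a' i), fun i => exp_mem_unitary_of_mem_skewAdjoint (ha'skew i), hkexp a' ha'K, fun i => ?_⟩
    have hg2 := hdef2 g hg
    have ha'n : ‖a' i‖ ≤ 1 / 2 + 3 * CA := by
      have h1 : ‖a' i‖ ≤ ‖B i‖ + ‖B i - a' i‖ := by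
        have := norm_sub_le (B i) (B i - a' i); rwa [sub_sub_cancel] at this
      have h2 : CA * (4 / 3) * ‖Λ g‖ ≤ 3 * CA := by nlinarith [norm_nonneg (Λ g)]
      linarith [hBn i, hBa' i]
    have hmax : max ‖B i‖ ‖a' i‖ ≤ 1 / 2 + 3 * CA := max_le (by linarith [hBn i]) ha'n
    calc ‖g i - exp (a' i)‖ = ‖exp (B i) - exp (a' i)‖ := by rw [hexpB]
      _ ≤ ‖B i - a' i‖ * Real.exp (max ‖B i‖ ‖a' i‖) := Literature.Analysis.Complex.norm_exp_sub_exp_le _ _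
      _ ≤ (CA * (4 / 3) * ‖Λ g‖) * Real.exp (1 / 2 + 3 * CA) :=
        mul_le_mul (hBa' i) (Real.exp_le_exp.mpr hmax) (Real.exp_nonneg _) (by positivity)
      _ = Cloc * ‖Λ g‖ := by rw [hCloc]; ring
  -- (C) GLOBALISATION by compactness
  set 𝒦 : Set (ι → Matrix n n ℂ) := {g | ∀ i, g i ∈ unitary (Matrix n n ℂ)} with h𝒦
  have h𝒦c : IsCompact 𝒦 := by
    have hU : IsCompact (unitary (Matrix n n ℂ) : Set (Matrix n n ℂ)) := by
      refine Metric.isCompact_of_isClosed_isBounded isClosed_unitary ?_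
      exact isBounded_iff_forall_norm_le.mpr ⟨1, fun u hu => (CStarRing.norm_of_mem_unitary hu).le⟩
    have e : 𝒦 = Set.pi Set.univ (fun _ : ι => (unitary (Matrix n n ℂ) : Set (Matrix n n ℂ))) := by
      ext g; simp [h𝒦]
    rw [e]
    exact isCompact_univ_pi fun _ => hU
  set U : Set (ι → Matrix n n ℂ) := {g | ∃ s₀ : ι → Matrix n n ℂ, (∀ i, s₀ i ∈ unitary (Matrix n n ℂ)) ∧ Λ s₀ = 0 ∧ ∀ i, ‖star (s₀ i) * g i - 1‖ < 1 / 4}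
    with hUdef
  have hUo : IsOpen U := by
    have e : U = ⋃ s₀ : ι → Matrix n n ℂ, ⋃ (_ : (∀ i, s₀ i ∈ unitary (Matrix n n ℂ)) ∧ Λ s₀ = 0),
        ⋂ i : ι, {g : ι → Matrix n n ℂ | ‖star (s₀ i) * g i - 1‖ < 1 / 4} := by
      ext g
      simp only [hUdef, mem_setOf_eq, mem_iUnion, mem_iInter, exists_prop, and_assoc]
    rw [e]
    refine isOpen_iUnion fun s₀ => isOpen_iUnion fun _ => isOpen_iInter_of_finite fun i => ?_
    exact isOpen_lt ((continuous_const.mul (continuous_apply i)).sub continuous_const).norm continuous_const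
  -- on `U`: the local lemma after translating by `s₀†`
  have honU : ∀ g ∈ 𝒦, g ∈ U → ∀ η : ℝ, 0 ≤ η → (∀ i b, ‖g i * Vb i b - Vb i b * g (nb i b)‖ ≤ η) →
      ∃ s : ι → Matrix n n ℂ, (∀ i, s i ∈ unitary (Matrix n n ℂ)) ∧ Λ s = 0 ∧ ∀ i, ‖g i - s i‖ ≤ Cloc * η := by
    intro g hg hgU η hη hdef
    obtain ⟨s₀, hs₀, hs₀K, hnear⟩ := hgU
    set g₁ : ι → Matrix n n ℂ := fun i => star (s₀ i) * g i with hg₁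
    have hg₁u : ∀ i, g₁ i ∈ unitary (Matrix n n ℂ) := fun i => Submonoid.mul_mem _ (Unitary.star_mem (hs₀ i)) (hg i)
    have hg₁1 : ∀ i, ‖g₁ i - 1‖ ≤ 1 / 4 := fun i => (hnear i).le
    -- same defect
    have hΛg₁ : ‖Λ g₁‖ ≤ η := by
      refine hΛnorm g₁ η hη fun i b => ?_
      have h0 := (hker s₀).mp hs₀K i b
      -- `Vb · star (s₀ (nb)) = star (s₀ i) · Vb`
      have h1 : Vb i b * star (s₀ (nb i b)) = star (s₀ i) * Vb i b := by
        have h2 := congrArg star (hconj s₀ hs₀K i b)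
        rw [star_mul, star_mul, star_star, ← mul_assoc] at h2
        -- `h2 : Vb · star (s₀ nb) · star Vb = star (s₀ i)`
        calc Vb i b * star (s₀ (nb i b)) = Vb i b * star (s₀ (nb i b)) * star (Vb i b) * Vb i b := by rw [mul_assoc _ (star (Vb i b)), hV1, mul_one]
          _ = star (s₀ i) * Vb i b := by rw [h2]
      have e1 : g₁ i * Vb i b - Vb i b * g₁ (nb i b) = star (s₀ i) * (g i * Vb i b - Vb i b * g (nb i b)) := by
        simp only [hg₁]
        rw [mul_sub, ← mul_assoc, ← mul_assoc, ← mul_assoc, h1]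
      rw [e1, CStarRing.norm_mem_unitary_mul _ (Unitary.star_mem (hs₀ i))]
      exact hdef i b
    obtain ⟨s₁, hs₁, hs₁K, hs₁n⟩ := hlocal g₁ hg₁u hg₁1
    refine ⟨fun i => s₀ i * s₁ i, fun i => Submonoid.mul_mem _ (hs₀ i) (hs₁ i), hkmul s₀ s₁ hs₀K hs₁K, fun i => ?_⟩
    have e2 : g i - s₀ i * s₁ i = s₀ i * (g₁ i - s₁ i) := by
      simp only [hg₁]
      rw [mul_sub, ← mul_assoc, Unitary.mul_star_self_of_mem (hs₀ i), one_mul]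
    rw [e2, CStarRing.norm_mem_unitary_mul _ (hs₀ i)]
    exact (hs₁n i).trans (mul_le_mul_of_nonneg_left hΛg₁ hCloc0)
  -- off `U`: the defect is bounded below on the compact `𝒦 \ U`
  have hΛcont : Continuous fun g : ι → Matrix n n ℂ => ‖Λ g‖ := (LinearMap.continuous_of_finiteDimensional Λ).norm
  obtain ⟨C₂, hC₂, hoff⟩ : ∃ C₂ : ℝ, 0 ≤ C₂ ∧ ∀ g ∈ 𝒦 \ U, 2 ≤ C₂ * ‖Λ g‖ := by
    by_cases hne : (𝒦 \ U).Nonempty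
    · obtain ⟨g₀, hg₀, hmin⟩ := (h𝒦c.diff hUo).exists_isMinOn hne hΛcont.continuousOn
      have hpos : 0 < ‖Λ g₀‖ := by
        rcases (norm_nonneg (Λ g₀)).lt_or_eq with h | h
        · exact h
        · exfalso
          have hz : Λ g₀ = 0 := norm_eq_zero.mp h.symm
          refine hg₀.2 ⟨g₀, hg₀.1, hz, fun i => ?_⟩
          rw [Unitary.star_mul_self_of_mem (hg₀.1 i), sub_self, norm_zero]; norm_num
      refine ⟨2 / ‖Λ g₀‖, by positivity, fun g hg => ?_⟩
      have h1 : ‖Λ g₀‖ ≤ ‖Λ g‖ := hmin hg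
      rw [div_mul_eq_mul_div, le_div_iff₀ hpos]
      nlinarith
    · exact ⟨0, le_rfl, fun g hg => (hne ⟨g, hg⟩).elim⟩
  -- THE CONSTANT
  refine ⟨max Cloc C₂, le_max_of_le_left hCloc0, fun g hg η hη hdef => ?_⟩
  have hgK : g ∈ 𝒦 := hg
  by_cases hgU : g ∈ U
  · obtain ⟨s, hs, hsK, hsn⟩ := honU g hgK hgU η hη hdef
    exact ⟨s, hs, (hker s).mp hsK, fun i => (hsn i).trans (mul_le_mul_of_nonneg_right (le_max_left _ _) hη)⟩
  · refine ⟨fun _ => 1, fun _ => Submonoid.one_mem _, (hker _).mp hkone, fun i => ?_⟩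
    have h2 : 2 ≤ C₂ * ‖Λ g‖ := hoff g ⟨hgK, hgU⟩
    have h3 : ‖Λ g‖ ≤ η := hΛnorm g η hη hdef
    calc ‖g i - 1‖ ≤ ‖g i‖ + ‖(1 : Matrix n n ℂ)‖ := norm_sub_le _ _
      _ = 2 := by rw [CStarRing.norm_of_mem_unitary (hg i), norm_one]; norm_num
      _ ≤ C₂ * ‖Λ g‖ := h2
      _ ≤ max Cloc C₂ * η := mul_le_mul (le_max_right _ _) h3 (norm_nonneg _) (le_max_of_le_left hCloc0)

end

end Summit.QuantumFields.BalabanUV.T4Continuum.NE7NearStabiliser
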